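import Summits.ResolutionOfSingularities.ResolutionOfSingularities.Theorems.MarkedTransferCampaignW13RFlatCanonicalPosSurface
import HarnessLib

/-!
# [OURS · L1 W1.3] Coordinate dependence of the canonical class `𝒞_can`: the surface singularity of
# `MarkedTransferCampaignW13RFlatCanonicalPosSurface.lean` PASSES POS in the coordinates `(x₁, x₁+x₂, u+x₁³)` (seat res-L1-s13-pv-1, g2)

LADDER-RESOLUTION rung L (rescue), cell `res-hironaka`, RESCUE-SEED slot W1.3 (architecture bypass, reading R-flat), F7′ rows
1 / 2(b). Companion of `…W13RFlatCanonicalPosSurface.lean` (the surface `g = u² + (x₁+x₂)³ + x₁⁵x₂`, `char K = 2`, isolated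
singular point, canonical tail `u` with `u² ∉ ℘_alg(((g),2),1)`). Here: the `K`-algebra INVOLUTION
`c : (x₁, x₂, u) ↦ (x₁, x₁ + x₂, u + x₁³)` of `K[x₁,x₂,u]` (`Sprime_coordChange_involutive`) carries `g` to
`G = v² + w³ + x₁⁵w` (`Sprime_aeval_coordChange`; `w = x₁ + x₂`, `v = u + x₁³`, written again in the variables `X 0, X 1, X 2`).
`G` is ALSO a canonical presentation of the SAME singularity (`ε' = w³ + x₁⁵w` has no square monomial; datum `e = 1`, tail `v`,
`r = 0`; `Sprime_isCanonicalChain`) and for it POS HOLDS, even in the Diff-form without integral closure: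
`v² = G + w·∂_w G ∈ Diff^{(1)}((G)) ⊆ ℘_alg(((G),2),1)` (`Sprime_tail_sq`, `Sprime_tail_sq_mem`, `Sprime_rFlatTailPow`). So the truth
value of o2's rung-1 content Prop on `𝒞_can` (p483384) is a property of the COORDINATE PRESENTATION — which `q`-th powers the
fixed `x`-coordinates let Hironaka's cleaning see (`x₁⁶ = x₁·x₁⁵` hides inside `x₁⁵x₂ = x₁⁵(x₁ + w)`, and `u = v + x₁³`) — not of
the singularity. Back in the ORIGINAL coordinates this reads (§2): the NON-canonical representative `v = u + x₁³` of the
cotangent vector `ū` (`v − u = x₁³ ∈ 𝔪₀²`) HAS `v² = g + (x₁+x₂)·∂₂g ∈ ℘_alg(((g),2),1)` (`S_shiftedTail_sq_mem`), so the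
résumé-level row 2(b) `CampaignW13Eq125Flat 1 L0inf ℘₁ 𝔪₀ {u}` IS re-fed at this surface point as soon as (107) holds for `v`
(`S_CampaignW13Eq125Flat_tail_of_eq107`). CORRECTION OF RECORD to the docstring (3) of `…W13RFlatCanonicalPosSurface.lean`
(p503083), which says «Row 1 / 2(b) … dead on surfaces with isolated singularities»: at the surface S only the CHAIN-LEVEL row 1
(POS for the canonical tail `u`) fails; row 2(b) survives through `v`; BOTH rows fail only where no regular parameter lies in
`Cot_flat`, i.e. at Narasimhan-type points (p501051 §4). Reading (prover's words; AI bookkeeping weaker than expert review): a repaired class «canonical in SOME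
coordinates» would no longer be the manuscript's coordinate-bound cleaning, and is refuted in general anyway by Narasimhan's head
(p501051 §4: there `Cot_flat ⊆ 𝔪₀²`, no regular tail in any coordinates). Caveat of record: nothing here bears on L-G4 / (127).

HONEST FRAMING. Nothing here is a statement of H. Hironaka's manuscript [Hironaka2017] (2017-03-23, lit key
`paper:url-3343fd9e678b`); OURS objects (bypass reading R-flat, `℘` bound algebraic, row 003 U17_2; candidate U17_4 not used).
AI computation is weaker than expert review; nothing here is progress on resolution of singularities in positive characteristic.
All decls `[folklore]`, sorry-free.
-/

noncomputable section

set_option linter.dupNamespace false -- mandated namespace of this single-conjunct summit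

namespace Summit.ResolutionOfSingularities.ResolutionOfSingularities.Theorems.Campaign

open MvPolynomial
open Literature.AlgebraicGeometry.Resolution
open Literature.AlgebraicGeometry.Hironaka2017
open Literature.AlgebraicGeometry.Hironaka2017.S09LLUED (LLChainData)

/-! ## The SAME singularity in the coordinates `(x₁, w, v) = (x₁, x₁ + x₂, u + x₁³)`: `G = v² + w³ + x₁⁵w` PASSES -/

namespace W13

section HeadSprime

variable (K : Type) [Field K] [CharP K 2]

/-- The substitution `c : x₁ ↦ x₁, x₂ ↦ x₁ + x₂, u ↦ u + x₁³` is an INVOLUTION of `K[x₁,x₂,u]` in characteristic `2`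
(`c(c(x_i)) = x_i`), hence a `K`-algebra automorphism — a change of coordinates at the origin. [folklore] -/
theorem Sprime_coordChange_involutive (i : Fin 3) :
    MvPolynomial.aeval ![(X 0 : MvPolynomial (Fin 3) K), X 0 + X 1, X 2 + X 0 ^ 3]
      ((![(X 0 : MvPolynomial (Fin 3) K), X 0 + X 1, X 2 + X 0 ^ 3]) i) = X i := by
  have h2 : (2 : MvPolynomial (Fin 3) K) = 0 := CharTwo.two_eq_zero
  fin_cases i
  · simp
  · simp only [Fin.mk_one, Matrix.cons_val_one, Matrix.cons_val_zero, map_add, MvPolynomial.aeval_X]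
    linear_combination (X 0 : MvPolynomial (Fin 3) K) * h2
  · simp only [Fin.reduceFinMk, Matrix.cons_val_two, Matrix.tail_cons, Matrix.head_cons, map_add, map_pow,
      MvPolynomial.aeval_X, Matrix.cons_val_zero]
    linear_combination (X 0 ^ 3 : MvPolynomial (Fin 3) K) * h2

/-- Under `c`, the surface `g = u² + (x₁+x₂)³ + x₁⁵x₂` becomes `G = v² + w³ + x₁⁵w` (same variables `X 0, X 1, X 2` for
`x₁, w, v`): `(v + x₁³)² + w³ + x₁⁵(x₁ + w) = v² + w³ + x₁⁵w` in characteristic `2`. [folklore] -/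
theorem Sprime_aeval_coordChange :
    MvPolynomial.aeval ![(X 0 : MvPolynomial (Fin 3) K), X 0 + X 1, X 2 + X 0 ^ 3]
        (X 2 ^ 2 + (X 0 ^ 3 + X 0 ^ 2 * X 1 + X 0 * X 1 ^ 2 + X 1 ^ 3 + X 0 ^ 5 * X 1) :
          MvPolynomial (Fin 3) K) = X 2 ^ 2 + (X 1 ^ 3 + X 0 ^ 5 * X 1) := by
  have h2 : (2 : MvPolynomial (Fin 3) K) = 0 := CharTwo.two_eq_zero
  simp only [map_add, map_pow, map_mul, MvPolynomial.aeval_X, Matrix.cons_val_zero, Matrix.cons_val_one,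
    Matrix.cons_val_two, Matrix.tail_cons, Matrix.head_cons]
  linear_combination (X 2 * X 0 ^ 3 + X 0 ^ 6 + 2 * X 0 ^ 3 + 3 * X 0 ^ 2 * X 1 + 2 * X 0 * X 1 ^ 2 :
    MvPolynomial (Fin 3) K) * h2

/-- In the new presentation the knock-out is a Diff-multiple: `∂_w G = w² + x₁⁵` and `v² = G + w·∂_w G` (characteristic `2`).
[folklore] -/
theorem Sprime_tail_sq :
    pderiv 1 (X 2 ^ 2 + (X 1 ^ 3 + X 0 ^ 5 * X 1) : MvPolynomial (Fin 3) K) = X 1 ^ 2 + X 0 ^ 5 ∧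
      (X 2 : MvPolynomial (Fin 3) K) ^ 2 =
        (X 2 ^ 2 + (X 1 ^ 3 + X 0 ^ 5 * X 1)) + X 1 * pderiv 1 (X 2 ^ 2 + (X 1 ^ 3 + X 0 ^ 5 * X 1) :
          MvPolynomial (Fin 3) K) := by
  have h2 : (2 : MvPolynomial (Fin 3) K) = 0 := CharTwo.two_eq_zero
  have h01 : (0 : Fin 3) ≠ 1 := by decide
  have h21 : (2 : Fin 3) ≠ 1 := by decide
  have hd : pderiv 1 (X 2 ^ 2 + (X 1 ^ 3 + X 0 ^ 5 * X 1) : MvPolynomial (Fin 3) K) = X 1 ^ 2 + X 0 ^ 5 := by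
    simp only [map_add, pderiv_mul, pderiv_pow, pderiv_X_self, pderiv_X_of_ne h01, pderiv_X_of_ne h21, mul_zero,
      zero_add, mul_one]
    push_cast
    linear_combination (X 1 ^ 2 : MvPolynomial (Fin 3) K) * h2
  refine ⟨hd, ?_⟩
  rw [hd]
  linear_combination (-(X 1 ^ 3 + X 0 ^ 5 * X 1) : MvPolynomial (Fin 3) K) * h2

/-- **POS HOLDS in the new coordinates**: `v² ∈ ℘_alg(((G),2),1)` — indeed in `Diff^{(1)}((G)) ⊆ ℘(Ě,1)` (p475548
`diffIdeal_le_pAlgPiece_one`), no integral closure needed. [folklore] -/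
theorem Sprime_tail_sq_mem :
    (X 2 : MvPolynomial (Fin 3) K) ^ 2 ∈
      Campaign.pAlgPiece K (Ideal.span {(X 2 ^ 2 + (X 1 ^ 3 + X 0 ^ 5 * X 1) : MvPolynomial (Fin 3) K)}) 2 1 := by
  have hmem : (X 2 ^ 2 + (X 1 ^ 3 + X 0 ^ 5 * X 1)) + X 1 * pderiv 1 (X 2 ^ 2 + (X 1 ^ 3 + X 0 ^ 5 * X 1) :
      MvPolynomial (Fin 3) K) ∈
        Campaign.pAlgPiece K (Ideal.span {(X 2 ^ 2 + (X 1 ^ 3 + X 0 ^ 5 * X 1) : MvPolynomial (Fin 3) K)}) 2 1 := by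
    refine diffIdeal_le_pAlgPiece_one K _ (by norm_num) (show 1 < 2 by norm_num) ?_
    exact Ideal.add_mem _ (le_diffIdeal K 1 _ (Ideal.subset_span rfl)) (mul_pderiv_mem_diffIdeal K 1 _ _ le_rfl)
  rwa [← (Sprime_tail_sq K).2] at hmem

omit [CharP K 2] in
/-- **The new presentation is CANONICAL too**: head `v² + ε'`, `ε' = w³ + x₁⁵w` free of `v`, no square monomial (`w³`: odd in
`w`; `x₁⁵w`: odd in `x₁`), tail `v`, `r = 0`, `e = 1`. [folklore] -/
theorem Sprime_isCanonicalChain (d : LLChainData (MvPolynomial (Fin 3) K))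
    (hdg : d.g 0 = X 2 ^ 2 + (X 1 ^ 3 + X 0 ^ 5 * X 1)) (hde : d.e = 1) (hdt : d.tail = X 2) :
    IsCanonicalChain 2 K (2 : Fin 3) d := by
  have hx0 : (X 0 : MvPolynomial (Fin 3) K) ∈ supported K ({2}ᶜ : Set (Fin 3)) :=
    (X_mem_supported (R := K)).mpr (by decide)
  have hx1 : (X 1 : MvPolynomial (Fin 3) K) ∈ supported K ({2}ᶜ : Set (Fin 3)) :=
    (X_mem_supported (R := K)).mpr (by decide)
  refine ⟨X 1 ^ 3 + X 0 ^ 5 * X 1, 0, ?_, by simp, ?_, by rw [hdt, add_zero], ?_⟩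
  · exact not_mem_vars_of_mem_supported (add_mem (pow_mem hx1 3) (mul_mem (pow_mem hx0 5) hx1))
  · rw [hdg, hde, pow_one]
  · rw [hde, pow_one, zero_pow two_ne_zero, sub_zero, X_pow_eq_monomial, X_pow_eq_monomial, X, monomial_mul]
    refine exists_odd_of_mem_support_add K ?_ ?_
    · exact exists_odd_of_mem_support_monomial K _ _ 1 (by rw [Finsupp.single_eq_same]; decide)
    · exact exists_odd_of_mem_support_monomial K _ _ 0
        (by rw [Finsupp.add_apply, Finsupp.single_eq_same, Finsupp.single_eq_of_ne (by decide)]; decide)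

/-- … and for it the content Prop's conclusion HOLDS: `RFlatTailPow 2 K ((G),2) d`. Same singularity, same class `𝒞_can`,
opposite verdicts — `𝒞_can` is presentation-dependent. [folklore] -/
theorem Sprime_rFlatTailPow (d : LLChainData (MvPolynomial (Fin 3) K))
    (hdg : d.g 0 = X 2 ^ 2 + (X 1 ^ 3 + X 0 ^ 5 * X 1)) (hde : d.e = 1) (hdt : d.tail = X 2) :
    Campaign.RFlatTailPow 2 K (Ideal.span {d.g 0}) (2 ^ d.e) d := by
  rw [Campaign.RFlatTailPow, hdg, hde, hdt, pow_one]
  exact Sprime_tail_sq_mem K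

end HeadSprime

/-! ## Back in the original coordinates: the résumé-level row 2(b) SURVIVES at the surface point -/

section Row2bSurvives

open Literature.AlgebraicGeometry.Hironaka2017.S11CoordFree (BlSub)

variable (K : Type) [Field K] [CharP K 2]

/-- In the ORIGINAL coordinates of the surface `g = u² + (x₁+x₂)³ + x₁⁵x₂`: the shifted tail `v = u + x₁³` satisfies
`v² = g + (x₁ + x₂)·∂₂g` (characteristic `2`; `∂₂g = (x₁+x₂)² + x₁⁵`, `W13.S_pderiv`). [folklore] -/
theorem S_shiftedTail_sq :
    (X 2 + X 0 ^ 3 : MvPolynomial (Fin 3) K) ^ 2 =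
      (X 2 ^ 2 + (X 0 ^ 3 + X 0 ^ 2 * X 1 + X 0 * X 1 ^ 2 + X 1 ^ 3 + X 0 ^ 5 * X 1)) +
        (X 0 + X 1) * pderiv 1 (X 2 ^ 2 + (X 0 ^ 3 + X 0 ^ 2 * X 1 + X 0 * X 1 ^ 2 + X 1 ^ 3 + X 0 ^ 5 * X 1) :
          MvPolynomial (Fin 3) K) := by
  have h2 : (2 : MvPolynomial (Fin 3) K) = 0 := CharTwo.two_eq_zero
  rw [(S_pderiv K).2.1]
  linear_combination (X 2 * X 0 ^ 3 - (X 0 ^ 3 + X 0 ^ 2 * X 1 + X 0 * X 1 ^ 2 + X 1 ^ 3 + X 0 ^ 5 * X 1) :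
    MvPolynomial (Fin 3) K) * h2

/-- … hence `v² ∈ ℘_alg(((g),2),1)` (Diff-form, p475548 `diffIdeal_le_pAlgPiece_one`): the cotangent vector `ū` HAS a
representative in the R-flat module at this point — the non-canonical `v = u + x₁³`. [folklore] -/
theorem S_shiftedTail_sq_mem :
    (X 2 + X 0 ^ 3 : MvPolynomial (Fin 3) K) ^ 2 ∈
      Campaign.pAlgPiece K (Ideal.span {(X 2 ^ 2 + (X 0 ^ 3 + X 0 ^ 2 * X 1 + X 0 * X 1 ^ 2 + X 1 ^ 3 + X 0 ^ 5 * X 1) :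
        MvPolynomial (Fin 3) K)}) 2 1 := by
  rw [S_shiftedTail_sq K]
  refine diffIdeal_le_pAlgPiece_one K _ (by norm_num) (show 1 < 2 by norm_num) ?_
  exact Ideal.add_mem _ (le_diffIdeal K 1 _ (Ideal.subset_span rfl)) (mul_pderiv_mem_diffIdeal K 1 _ _ le_rfl)

/-- **Row 2(b) is RE-FED at the surface point** (o2's schema p483384 `CampaignW13Eq125Flat`, level `e = 1`, `P1 = ℘_alg` bound,
`𝔪 = 𝔪₀`, cotangent datum `V = {u}`): GIVEN the (107)-type hypothesis for the representative `v = u + x₁³` (row 081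
`Thm14_2_eq107`, a CANDIDATE consumed as a hypothesis: `ρ(v) ∈ ∥𝔏₀(∞)∥`), `v ∈ Cot_flat` and `v − u = x₁³ ∈ 𝔪₀²`. So at S the
chain-level row 1 fails (p503083) while the résumé datum (125) is unchanged. [folklore] -/
theorem S_CampaignW13Eq125Flat_tail_of_eq107 {ℓ : ℕ} (L0inf : BlSub (MvPolynomial (Fin 3) K) 2 ℓ)
    (h107 : iterateFrobenius (MvPolynomial (Fin 3) K) 2 1 (X 2 + X 0 ^ 3) ∈
      S12GLUED.fnorm (↥(iterateFrobenius (MvPolynomial (Fin 3) K) 2 ℓ).range) L0inf) :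
    CampaignW13Eq125Flat 1 L0inf
      (Campaign.pAlgPiece K (Ideal.span {(X 2 ^ 2 + (X 0 ^ 3 + X 0 ^ 2 * X 1 + X 0 * X 1 ^ 2 + X 1 ^ 3 + X 0 ^ 5 * X 1) :
        MvPolynomial (Fin 3) K)}) 2 1) (idealOfVars (Fin 3) K) {(X 2 : MvPolynomial (Fin 3) K)} := by
  intro v hv
  rw [Set.mem_singleton_iff] at hv
  subst hv
  refine ⟨X 2 + X 0 ^ 3, (mem_bypassCotRFlat_iff 1 L0inf _ _).mpr ⟨h107, ?_⟩, ?_⟩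
  · rw [pow_one]
    exact S_shiftedTail_sq_mem K
  · rw [add_sub_cancel_left, X_pow_eq_monomial, monomial_mem_pow_idealOfVars_iff _ _ one_ne_zero, Finsupp.degree_single]
    norm_num

end Row2bSurvives

end W13

end Summit.ResolutionOfSingularities.ResolutionOfSingularities.Theorems.Campaign

end
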